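import Summits.NavierStokesRegularity.NavierStokesRegularity.Theses.FilamentSkeletonRss
import Summits.NavierStokesRegularity.NavierStokesRegularity.Theorems.TypeIDSSLiouvilleConjecture
import Summits.NavierStokesRegularity.NavierStokesRegularity.Theorems.FilamentSkeletonRssCoreGluingVacuous

/-!
# Route `FilamentSkeletonRss` · crux `CoreGluing` (stmt-NavierStokesRegularity-15401) — reduction to the wall

Line lead c7 (2026-08-17).  `CoreGluing := SkeletonEquilibrium → RssProfileExists` is a material
implication between two closed propositions (`coreGluing_iff_not_skeletonEquilibrium_or_rssProfileExists`,
p140859).  Its second disjunct, the route TARGET `RssProfileExists`, is — verbatim — a counterexample to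
the canonical open conjecture `Summit.NavierStokesRegularity.NavierStokesRegularity.TypeIDSSLiouvilleConjecture`
(the Type-I (rotated) DSS Liouville wall, Tsai GSM 192 Conj. 8.8–8.9 = Bradshaw–Tsai 2017 Open Problem 5.1):
an RSS field is rotated `2`-DSS with the isometry `R(−2α log 2)`, ancient mild, measurable, Type-I bounded,
and its slice `u(−1) = U` is continuous and `≠ 0`, hence not a.e. zero
(`rssProfileExists_not_typeIDSSLiouvilleConjecture`).

Consequently, UNDER THE WALL the crux is literally the negation of its sibling crux
`SkeletonEquilibrium` (stmt-NavierStokesRegularity-15400):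
`TypeIDSSLiouvilleConjecture → (CoreGluing ↔ ¬ SkeletonEquilibrium)`
(`coreGluing_iff_not_skeletonEquilibrium_of_wall`), and unconditionally at least one of the two sibling
cruxes holds (`coreGluing_or_skeletonEquilibrium`) while under the wall they cannot both hold
(`not_skeletonEquilibrium_and_coreGluing_of_wall`).  This is the typed form of the line leads' verdict
"15401 is blocked on 15400": every proof of `CoreGluing` that does not refute the wall is a proof of
`¬ SkeletonEquilibrium`, and every refutation of `CoreGluing` proves `SkeletonEquilibrium` (and, by
`CoreGluing.Negative.not_coreGluing_iff`, the RSS Liouville statement in the filament window).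
-/

set_option linter.dupNamespace false

namespace Summit.NavierStokesRegularity.NavierStokesRegularity.Theorems

open Summit.NavierStokesRegularity.NavierStokesRegularity.Theses.FilamentSkeletonRss
open MeasureTheory

/-- **The target refutes the rotated Type-I DSS Liouville statement at factor `2`.**  An RSS field as in
`RssProfileExists` is, at the factor `c = 2`, rotated discretely self-similar with the pinned isometry
`R(−2α log 2)`, ancient mild with measurable slices and Type-I bounded; its slice at `t = −1` is the
continuous nontrivial profile `U`, so it is not a.e. zero — contradicting
`RotatedTypeIDSSLiouville 2 (R(−2α log 2))`. [cite: BradshawTsai2017CPDE, §5 Open Problem 5.1] -/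
theorem rssProfileExists_not_rotatedTypeIDSSLiouville (h : RssProfileExists) :
    ∃ R : EuclideanSpace ℝ (Fin 3) ≃ₗᵢ[ℝ] EuclideanSpace ℝ (Fin 3),
      ¬ Literature.Analysis.FluidPDE.RotatedTypeIDSSLiouville 2 R := by
  obtain ⟨α, C₀, U, Rot, u, -, -, hU2, hU0, hu1, hrss, hmild, hmeas, hC⟩ := h
  refine ⟨Rot (-(α * (2 * Real.log 2))), fun hL => ?_⟩
  have h1 := hL one_lt_two u hmild hmeas (hrss 2 two_pos) ⟨C₀, hC⟩ (-1) (by norm_num)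
  rw [hu1] at h1
  exact hU0 ((Continuous.ae_eq_iff_eq volume hU2.continuous continuous_const).1 h1)

/-- **The target refutes the wall.**  `RssProfileExists → ¬ TypeIDSSLiouvilleConjecture` (canonical
conjecture leaf `Theorems/TypeIDSSLiouvilleConjecture.lean`: for every factor, the plain and all rotated
Type-I DSS Liouville statements). [cite: BradshawTsai2017CPDE, §5 Open Problem 5.1] -/
theorem rssProfileExists_not_typeIDSSLiouvilleConjecture (h : RssProfileExists) :
    ¬ Summit.NavierStokesRegularity.NavierStokesRegularity.TypeIDSSLiouvilleConjecture := by
  intro hW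
  obtain ⟨R, hR⟩ := rssProfileExists_not_rotatedTypeIDSSLiouville h
  exact hR ((hW 2).2 R)

/-- **Under the wall the target is false.** [folklore] -/
theorem not_rssProfileExists_of_wall
    (hW : Summit.NavierStokesRegularity.NavierStokesRegularity.TypeIDSSLiouvilleConjecture) :
    ¬ RssProfileExists :=
  fun h => rssProfileExists_not_typeIDSSLiouvilleConjecture h hW

/-- **Under the wall, the crux is the negation of its sibling.**
`TypeIDSSLiouvilleConjecture → (CoreGluing ↔ ¬ SkeletonEquilibrium)`: the typed form of "crux
stmt-15401 is decided by stmt-15400" — modulo the standing conjecture, proving `CoreGluing` IS refuting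
`SkeletonEquilibrium`, and refuting `CoreGluing` IS proving it. [folklore] -/
theorem coreGluing_iff_not_skeletonEquilibrium_of_wall
    (hW : Summit.NavierStokesRegularity.NavierStokesRegularity.TypeIDSSLiouvilleConjecture) :
    CoreGluing ↔ ¬ SkeletonEquilibrium :=
  ⟨fun hK2 hK1 => not_rssProfileExists_of_wall hW (hK2 hK1), coreGluing_of_not_skeletonEquilibrium⟩

/-- Contrapositive form: under the wall, `¬ CoreGluing ↔ SkeletonEquilibrium`. [folklore] -/
theorem not_coreGluing_iff_skeletonEquilibrium_of_wall
    (hW : Summit.NavierStokesRegularity.NavierStokesRegularity.TypeIDSSLiouvilleConjecture) :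
    ¬ CoreGluing ↔ SkeletonEquilibrium := by
  rw [coreGluing_iff_not_skeletonEquilibrium_of_wall hW, not_not]

/-- **At least one sibling crux holds** (unconditionally): `CoreGluing ∨ SkeletonEquilibrium` — the two
cruxes stmt-15400 / stmt-15401 cannot both be refuted. [folklore] -/
theorem coreGluing_or_skeletonEquilibrium : CoreGluing ∨ SkeletonEquilibrium := by
  by_cases h : SkeletonEquilibrium
  · exact Or.inr h
  · exact Or.inl (coreGluing_of_not_skeletonEquilibrium h)

/-- **Under the wall the two sibling cruxes cannot both hold**: `SkeletonEquilibrium ∧ CoreGluing` gives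
the target, which refutes the wall.  (So, modulo the conjecture, exactly one of stmt-15400 / stmt-15401
is true, and the route — which needs both — is closed off exactly by the wall it sets out to breach.)
[folklore] -/
theorem not_skeletonEquilibrium_and_coreGluing_of_wall
    (hW : Summit.NavierStokesRegularity.NavierStokesRegularity.TypeIDSSLiouvilleConjecture) :
    ¬ (SkeletonEquilibrium ∧ CoreGluing) :=
  fun h => not_rssProfileExists_of_wall hW (h.2 h.1)

/-- Registered tools stub of crux stmt-NavierStokesRegularity-15401 (`ledger workitem stub-add … --name
stub_wallReductionTools`): the conjunction of the wall-reduction facts of this file — the target refutes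
the wall; under the wall the crux is the negation of its sibling; one sibling always holds; under the wall
not both. [folklore] -/
theorem stub_wallReductionTools :
    (Summit.NavierStokesRegularity.NavierStokesRegularity.Theses.FilamentSkeletonRss.RssProfileExists → ¬ Summit.NavierStokesRegularity.NavierStokesRegularity.TypeIDSSLiouvilleConjecture) ∧ (Summit.NavierStokesRegularity.NavierStokesRegularity.TypeIDSSLiouvilleConjecture → (Summit.NavierStokesRegularity.NavierStokesRegularity.Theses.FilamentSkeletonRss.CoreGluing ↔ ¬ Summit.NavierStokesRegularity.NavierStokesRegularity.Theses.FilamentSkeletonRss.SkeletonEquilibrium)) ∧ (Summit.NavierStokesRegularity.NavierStokesRegularity.Theses.FilamentSkeletonRss.CoreGluing ∨ Summit.NavierStokesRegularity.NavierStokesRegularity.Theses.FilamentSkeletonRss.SkeletonEquilibrium) ∧ (Summit.NavierStokesRegularity.NavierStokesRegularity.TypeIDSSLiouvilleConjecture → ¬ (Summit.NavierStokesRegularity.NavierStokesRegularity.Theses.FilamentSkeletonRss.SkeletonEquilibrium ∧ Summit.NavierStokesRegularity.NavierStokesRegularity.Theses.FilamentSkeletonRss.CoreGluing)) :=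
  ⟨rssProfileExists_not_typeIDSSLiouvilleConjecture, coreGluing_iff_not_skeletonEquilibrium_of_wall,
    coreGluing_or_skeletonEquilibrium, not_skeletonEquilibrium_and_coreGluing_of_wall⟩

end Summit.NavierStokesRegularity.NavierStokesRegularity.Theorems
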